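import Summits.QuantumFields.YangMills.Theorems.PencilRigidityWeakCouplingHypercubicLimitOfUfbSkewCore
import Summits.QuantumFields.YangMills.Theorems.MirrorModularBoostsHypercubicLimitConvergenceSubseq
import Literature.MathematicalPhysics.QuantumFieldTheory.SchwartzTensorNorms
import HarnessLib

/-!
# Crux `WeakCouplingHypercubicLimit` (stmt-QuantumFields-16120) from the UFB CORE — the order-one moment bound is redundant

Line `Sketch` of crux stmt-16120, continuation lead c5, variant r12″ of the skew-core reduction.  The landed closure
`weakCouplingHypercubicLimit_of_ufbSkewCore` (`…OfUfbSkewCore.lean`) runs from the `k`-uniform FUNCTIONAL bound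
`UniformFunctionalBoundPlanes r sch` (`‖planeDist_k n q F‖ ≤ α (n!)^β |F|_{ns}` on `⁰𝒮`, uniformly in `k`) but still carries the
ORDER-ONE moment bound `∃ s C, ∀ F, normP s F ≤ 1 → ∀ k, |∫ fieldP r sch k F dμ_k| ≤ C` as a separate conjunct.  Here:

* `momentOne_of_ufb` — the order-one moment bound FOLLOWS from `UniformFunctionalBoundPlanes` at arity `n = 1`:
  `∫ Φ^P_k(F) dμ_k = Σ_q ∫ Φ^{q}_k(F_q) dμ_k`, each summand is the arity-one plane-string distribution on the real tensor
  `⊗₁ F_q` (`planeDist_eq_integral_prod_planeField`), every arity-one test function is off-diagonal, and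
  `|⊗₁ f|_s ≤ 2^{s+1} |f|_s` (`schwartzNorm_tensorFin_le`); summing over the six planes gives the constant `|α| 2^{s+1}`;
* `weakCouplingHypercubicLimit_of_ufbCore` — the crux BY NAME from the UFB CORE (the UFB skew core WITHOUT the order-one
  conjunct).

Refs: OsterwalderSchrader1975 §2 (E0′); GlimmJaffe1987 §6.1.
-/

noncomputable section

open scoped SchwartzMap
open MeasureTheory Filter Topology
open Literature.MathematicalPhysics.AQFT Literature.MathematicalPhysics.QuantumLattice
open Literature.MathematicalPhysics.QuantumFieldTheory
open Summit.QuantumFields.YangMills.Cruxes.HypercubicLimit.CouplingResponse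

namespace Summit.QuantumFields.YangMills.Theorems.WeakCouplingHypercubicLimit.TraceNormColdPressure

section Helpers

variable {G : Type} [Group G] [TopologicalSpace G] [IsTopologicalGroup G] [CompactSpace G]
  [MeasurableSpace G] [BorelSpace G]

/-- The Wilson moment of ONE smeared plane field is the renormalised arity-one plane-string distribution on the real
tensor `⊗₁ f` (`planeDist_eq_integral_prod_planeField` at `n = 1`). [folklore] -/
theorem integral_planeField_eq_planeDist_one (r : LatticeRep G) (sch : SpeciesScheme (YMSpecies G)) (k : ℕ)
    (q : Plane) (f : 𝓢(EuclideanSpace ℝ (Fin 4), ℝ)) :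
    ((∫ U, planeField r sch k q f U ∂(wilsonAt r sch k) : ℝ) : ℂ) =
      planeDist r sch k 1 (fun _ => q) (SchwartzMap.tensorFin 1 ![ofRealTest f]) := by
  have hF : IsTensorOf (SchwartzMap.tensorFin 1 ![ofRealTest f]) (fun i => ofRealTest (![f] i)) := by
    have h : (fun i => ofRealTest (![f] i)) = ![ofRealTest f] := by
      funext i
      fin_cases i
      rfl
    rw [h]
    exact isTensorOf_tensorFin _
  rw [planeDist_eq_integral_prod_planeField G r sch k 1 (fun _ => q) ![f] _ hF]
  simp only [Fin.prod_univ_one, Matrix.cons_val_fin_one]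

/-- **The arity-one case of the uniform functional bound, per plane**: `|∫ Φ^{q}_k(f) dμ_k| ≤ |α| 2^{s+1} |f|_s` for
every step `k`, plane `q` and real test `f`. [folklore] -/
theorem abs_integral_planeField_le_of_ufb (r : LatticeRep G) (sch : SpeciesScheme (YMSpecies G)) {s : ℕ} {α β : ℝ}
    (hb : ∀ (n : ℕ) (q : Fin n → Plane) (F : 𝓢((Fin n → EuclideanSpace ℝ (Fin 4)), ℂ)),
      IsOffDiagonal F → ∀ k : ℕ, ‖planeDist r sch k n q F‖ ≤ α * (n.factorial : ℝ) ^ β * schwartzNorm (n * s) F)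
    (k : ℕ) (q : Plane) (f : 𝓢(EuclideanSpace ℝ (Fin 4), ℝ)) :
    |∫ U, planeField r sch k q f U ∂(wilsonAt r sch k)| ≤ |α| * 2 ^ (s + 1) * schwartzNorm s (ofRealTest f) := by
  set F₁ : 𝓢((Fin 1 → EuclideanSpace ℝ (Fin 4)), ℂ) := SchwartzMap.tensorFin 1 ![ofRealTest f] with hF₁
  have h1 : |∫ U, planeField r sch k q f U ∂(wilsonAt r sch k)| = ‖planeDist r sch k 1 (fun _ => q) F₁‖ := by
    rw [← integral_planeField_eq_planeDist_one, Complex.norm_real, Real.norm_eq_abs]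
  rw [h1]
  have hod : IsOffDiagonal F₁ := isOffDiagonal_of_subsingleton F₁
  refine (hb 1 (fun _ => q) F₁ hod k).trans ?_
  simp only [Nat.factorial_one, Nat.cast_one, Real.one_rpow, mul_one, one_mul]
  have hn : schwartzNorm s F₁ ≤ 2 ^ (s + 1) * schwartzNorm s (ofRealTest f) := by
    have h := schwartzNorm_tensorFin_le ![ofRealTest f] s
    simpa [Fin.prod_univ_one] using h
  calc α * schwartzNorm s F₁ ≤ |α| * schwartzNorm s F₁ :=
        mul_le_mul_of_nonneg_right (le_abs_self α) (schwartzNorm_nonneg _ _)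
    _ ≤ |α| * (2 ^ (s + 1) * schwartzNorm s (ofRealTest f)) := mul_le_mul_of_nonneg_left hn (abs_nonneg α)
    _ = |α| * 2 ^ (s + 1) * schwartzNorm s (ofRealTest f) := by ring

/-- The Wilson moment of the anisotropically smeared field is the sum of the six plane moments. [folklore] -/
theorem integral_fieldP_eq_sum (r : LatticeRep G) (sch : SpeciesScheme (YMSpecies G)) (k : ℕ)
    (F : Plane → 𝓢(EuclideanSpace ℝ (Fin 4), ℝ)) :
    ∫ U, fieldP r sch k F U ∂(wilsonAt r sch k) = ∑ q, ∫ U, planeField r sch k q (F q) U ∂(wilsonAt r sch k) := by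
  haveI : IsProbabilityMeasure (wilsonAt r sch k) :=
    isProbabilityMeasure_wilsonMeasure (d := 4) (L := sch.side k) r.ρ r.continuous (sch.β k)
  have hint : ∀ q : Plane, Integrable (fun U => planeField r sch k q (F q) U) (wilsonAt r sch k) := fun q =>
    IsBddMeas.integrable ⟨measurable_planeField r sch k q (F q), exists_bound_planeField r sch k q (F q)⟩ _
  unfold fieldP
  exact integral_finsetSum _ fun q _ => hint q

end Helpers

/-- **Registered sub-goal `momentOne_of_ufb` (line `Sketch`, r12″): the order-one moment bound follows from the uniform
functional bound at arity one.**  With `⟨s, α, β⟩` the data of `UniformFunctionalBoundPlanes r sch`, for every 6-tuple `F` with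
`normP s F ≤ 1` and every `k`: `|∫ Φ^P_k(F) dμ_k| ≤ Σ_q |∫ Φ^{q}_k(F_q) dμ_k| ≤ |α| 2^{s+1} Σ_q |F_q|_s ≤ |α| 2^{s+1}`. [folklore] -/
theorem momentOne_of_ufb : ∀ (G : Type) [Group G] [TopologicalSpace G] [IsTopologicalGroup G] [CompactSpace G] [MeasurableSpace G] [BorelSpace G] (r : LatticeRep G) (sch : SpeciesScheme (YMSpecies G)), UniformFunctionalBoundPlanes r sch → ∃ (s : ℕ) (C : ℝ), ∀ F : Plane → 𝓢(EuclideanSpace ℝ (Fin 4), ℝ), normP s F ≤ 1 → ∀ k : ℕ, |∫ U, fieldP r sch k F U ∂(wilsonAt r sch k)| ≤ C := by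
  intro G _ _ _ _ _ _ r sch hUFB
  obtain ⟨s, α, β, hb⟩ := hUFB
  refine ⟨s, |α| * 2 ^ (s + 1), fun F hF k => ?_⟩
  rw [integral_fieldP_eq_sum]
  have hC : 0 ≤ |α| * 2 ^ (s + 1) := by positivity
  calc |∑ q, ∫ U, planeField r sch k q (F q) U ∂(wilsonAt r sch k)|
      ≤ ∑ q, |∫ U, planeField r sch k q (F q) U ∂(wilsonAt r sch k)| := Finset.abs_sum_le_sum_abs _ _
    _ ≤ ∑ q, |α| * 2 ^ (s + 1) * schwartzNorm s (ofRealTest (F q)) :=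
        Finset.sum_le_sum fun q _ => abs_integral_planeField_le_of_ufb r sch hb k q (F q)
    _ = |α| * 2 ^ (s + 1) * normP s F := by rw [normP, Finset.mul_sum]
    _ ≤ |α| * 2 ^ (s + 1) * 1 := mul_le_mul_of_nonneg_left hF hC
    _ = |α| * 2 ^ (s + 1) := mul_one _

/-- **The crux `WeakCouplingHypercubicLimit` (stmt-16120) BY NAME from the UFB CORE** — registered sub-goal of line `Sketch`, r12″:
weak coupling ∧ `PolyVolume` ∧ `PolyRenorm` ∧ `UniformFunctionalBoundPlanes` ∧ (uniform lattice gap ∧ its RP-spectral form) ∧ ONE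
time-separated `κ₃` floor ⇒ the existence-minus-rotations leg of `YangMills` in one-field gauge at weak coupling; the order-one moment
bound of the UFB skew core is supplied by `momentOne_of_ufb`. [folklore] -/
theorem weakCouplingHypercubicLimit_of_ufbCore : (∀ (G : Type) [Group G] [TopologicalSpace G] [IsTopologicalGroup G] [CompactSpace G] [MeasurableSpace G] [BorelSpace G], IsCompactSimpleLieGroup G → ∃ (r : LatticeRep G) (sch : SpeciesScheme (YMSpecies G)), sch.HasWeakCouplingLimit ∧ PolyVolume sch ∧ PolyRenorm r sch ∧ UniformFunctionalBoundPlanes r sch ∧ (∃ Δ C : ℝ, 0 < Δ ∧ HasLatticeMassGap r sch Δ ∧ RPSpectral r sch Δ C) ∧ (∃ (f g h : 𝓢(EuclideanSpace ℝ (Fin 4), ℝ)) (δ : ℝ), tsupport f ⊆ {y : EuclideanSpace ℝ (Fin 4) | y 0 < 0} ∧ tsupport g ⊆ {y : EuclideanSpace ℝ (Fin 4) | 0 < y 0} ∧ tsupport h ⊆ {y : EuclideanSpace ℝ (Fin 4) | 0 < y 0} ∧ Disjoint (tsupport g) (tsupport h) ∧ 0 < δ ∧ ∀ᶠ k in atTop,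 δ ≤ |latticeSchwinger r.ρ sch (fun s => s.F) k 3 (fun _ => r.curvature) ![f, g, h] - latticeSchwinger r.ρ sch (fun s => s.F) k 1 (fun _ => r.curvature) ![f] * latticeSchwinger r.ρ sch (fun s => s.F) k 2 (fun _ => r.curvature) ![g, h] - latticeSchwinger r.ρ sch (fun s => s.F) k 1 (fun _ => r.curvature) ![g] * latticeSchwinger r.ρ sch (fun s => s.F) k 2 (fun _ => r.curvature) ![f, h] - latticeSchwinger r.ρ sch (fun s => s.F) k 1 (fun _ => r.curvature) ![h] * latticeSchwinger r.ρ sch (fun s => s.F) k 2 (fun _ => r.curvature) ![f, g] + 2 * (latticeSchwinger r.ρ sch (fun s => s.F) k 1 (fun _ => r.curvature) ![f] * latticeSchwinger r.ρ sch (fun s => s.F) k 1 (fun _ => r.curvature) ![g] * latticeSchwinger r.ρ sch (fun s => s.F) k 1 (fun _ => r.curvature) ![h])|)) → Summit.QuantumFields.YangMills.Theses.PencilRigidity.WeakCouplingHypercubicLimit := by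
  intro hcore
  refine weakCouplingHypercubicLimit_of_ufbSkewCore fun G _ _ _ _ _ _ hG => ?_
  obtain ⟨r, sch, hw, hpv, hpr, hUFB, hIR, hNG⟩ := hcore G hG
  exact ⟨r, sch, hw, hpv, hpr, hUFB, momentOne_of_ufb G r sch hUFB, hIR, hNG⟩

end Summit.QuantumFields.YangMills.Theorems.WeakCouplingHypercubicLimit.TraceNormColdPressure

end
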